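import Summits.FinalStateConjecture.FinalStateConjecture.Theorems.PhotonSphereChannelsChannelsResolveTameDevelopmentsRKerrDevBasics
import Summits.FinalStateConjecture.FinalStateConjecture.Theorems.PhotonSphereChannelsChannelsResolveTameDevelopmentsRKerrDevTransport
import Literature.Topology.Euclidean.InvarianceOfDomain
import HarnessLib

/-!
# Route PhotonSphereChannels · crux `ChannelsResolveTameDevelopmentsR` (K2R, stmt-FinalStateConjecture-14075) — upper
# semicontinuity of the anchored Kerr window deviation `kerrDev` with scale loss (line `kerr-isolation-dichotomy`,
# lead c2; stub-worker S5, supports stub S5 `stub_hullConnectedness` and S1's dictionary)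

Stub S5 (band visiting of `s ↦ kerrDev 𝒟 (γ s) R` along a late observer) reduces, by the first-hitting-time lemmas
of the companion file `…RHullConnectednessIVT.lean`, to two one-sided regularity properties of that function: upper
semicontinuity from the right and "no upward jump on arrival from the left". This file proves the half that is FREE
for every smooth spacetime, in the sharp form the present definition of `kerrDev` (open, non-extendable windows
`B_R(x₀) ∩ {r > r₊}`) allows — registered sub-goal `stub_kerrDev_usc_scaleLoss`:

* if `kerrDev 𝓢 q R < ε` and `R' < R` then `kerrDev 𝓢 q' R' < ε` for all `q'` near `q`.

Proof: re-anchor ONE near-optimal anchored window chart `Ψ` (anchor `x₀`; `kerrDev_lt_iff`) at the nearby anchors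
`x₀' ∈ B_{R−R'}(x₀) ∩ {r > r₊}` — the same map is an anchored window chart at `Ψ x₀'` on the smaller window
`B_{R'}(x₀') ⊆ B_R(x₀)` (`isWindowChart_reanchor`) with no larger `C²` deviation (`kerrDev_apply_lt_of_isWindowChart`) —
and use that `Ψ(B_{R−R'}(x₀) ∩ {r > r₊})` is a NEIGHBOURHOOD of `q = Ψ x₀` (`image_mem_nhds_of_isWindowChart`): a
continuous injection of an open subset of `E4` into the topological `4`-manifold `𝓢` is open — Brouwer's invariance of
domain (`Literature.Topology.Euclidean.Brouwer.isOpen_image_of_injOn`, Tao 2014 Thm. 6.0.12) read in a chart of `𝓢`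
(`isOpen_image_of_continuousOn_injOn_opens`, adapted from `Literature/Geometry/Riemannian/CutLocusDimension.lean`). No
smallness of the deviation and no inverse function theorem is needed.

Consequences: the OUTER functional `q ↦ ⨅ R' > R, kerrDev 𝓢 q R'` (charts extendable beyond scale `R`) is upper
semicontinuous at FIXED scale (`upperSemicontinuous_iInf_kerrDev`), also in time along continuous paths
(`upperSemicontinuous_iInf_kerrDev_comp`) — this is what a Reshape of `kerrDev` to extendable charts would buy; at fixed
scale `R` itself the present `kerrDev` only inherits `kerrDev 𝓢 (γ t) R < b ⇒ kerrDev 𝓢 (γ s) R' < b` near `t` for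
`R' < R` (`eventually_kerrDev_comp_lt_of_lt`), i.e. hypothesis (R-USC_b) of `stub_hullConnectedness_of_oneSided` up to
the scale loss. The scale loss is genuine: charts on the open ball `B_R(x₀)` need not extend, and
`sup_{R' < R} kerrDev q R' = kerrDev q R` would itself be a chart-gluing (compactness) statement.

References: Tao 2014, Thm. 6.0.12 (invariance of domain) [Tao2014]; the `Cᵏ` closeness functional is modelled on DHRT
arXiv:2104.08222 §1 [arXiv210408222]; Anderson 2004, §5 [Anderson2004].
-/

noncomputable section

-- the operator-norm instance on `E4 →L[ℝ] E4 →L[ℝ] ℝ` needs one more level of pending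
-- instance problems than the default (as in `PhotonSphereChannelsKerrDevDefs.lean`)
set_option maxSynthPendingDepth 3
-- every `Summit.FinalStateConjecture.FinalStateConjecture.…` name repeats the summit = sub-problem segment (D-0017 layout)
set_option linter.dupNamespace false

open Set Filter Function TopologicalSpace Manifold Bundle
open scoped Topology Manifold ContDiff ENNReal NNReal

namespace Summit.FinalStateConjecture.FinalStateConjecture.Theorems

open Literature.Geometry.Lorentzian
open Summit.FinalStateConjecture.FinalStateConjecture.Theorems.TameHull

/-! ### Invariance of domain for window charts, re-anchoring, and upper semicontinuity with scale loss -/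

/-- **Invariance of domain for maps from an open subset of `E4` into a `4`-manifold.** If `U ⊆ E4` is open, `N` is a
topological manifold modelled on `E4` and `f : U → N` is continuous and injective on an open `V ⊆ U`, then `f '' V` is
open in `N`: read `f` in a chart `φ` of `N` at `f x`; `φ ∘ f ∘ val⁻¹` is a continuous injection of the open coordinate
set `val '' (V ∩ f ⁻¹' φ.source) ⊆ E4` into `E4`, so its image is open by Brouwer's invariance of domain
(`Literature.Topology.Euclidean.Brouwer.isOpen_image_of_injOn`), and its `φ`-preimage inside `φ.source` is an open
neighbourhood of `f x` inside `f '' V`. [cite: Tao2014, Thm. 6.0.12] -/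
theorem isOpen_image_of_continuousOn_injOn_opens {U : Opens E4} {N : Type*} [TopologicalSpace N]
    [ChartedSpace E4 N] {f : U → N} {V : Set U} (hV : IsOpen V) (hf : ContinuousOn f V)
    (hinj : InjOn f V) : IsOpen (f '' V) := by
  -- adapted from `Literature/Geometry/Riemannian/CutLocusDimension.lean` (`isOpen_image_of_continuousOn_injOn`)
  classical
  rw [isOpen_iff_mem_nhds]
  rintro _ ⟨x, hx, rfl⟩
  set φ := chartAt E4 (f x) with hφ
  -- the part of `V` mapped into the chart domain and its open coordinate image
  set V' : Set U := V ∩ f ⁻¹' φ.source with hV'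
  have hV'o : IsOpen V' := hf.isOpen_inter_preimage hV φ.open_source
  have hxV' : x ∈ V' := ⟨hx, mem_chart_source E4 (f x)⟩
  set W : Set E4 := Subtype.val '' V' with hW
  have hWo : IsOpen W := U.isOpen.isOpenMap_subtype_val V' hV'o
  -- `f` read in the chart, extended by junk off `U`
  set g : E4 → E4 := fun y ↦ if h : y ∈ U then φ (f ⟨y, h⟩) else 0 with hg
  have hgval : ∀ z : U, g z.1 = φ (f z) := fun z ↦ by
    show (if h : (z : E4) ∈ U then φ (f ⟨z, h⟩) else 0) = φ (f z)
    rw [dif_pos z.2]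
  have hgcomp : g ∘ Subtype.val = φ ∘ f := funext fun z ↦ hgval z
  have hemb : Topology.IsOpenEmbedding (Subtype.val : U → E4) := U.isOpen.isOpenEmbedding_subtypeVal
  have hgc : ContinuousOn g W := by
    refine hWo.continuousOn_iff.2 ?_
    rintro _ ⟨z, hz, rfl⟩
    have h1 : ContinuousAt (φ ∘ f) z :=
      (φ.continuousAt hz.2).comp (hf.continuousAt (hV.mem_nhds hz.1))
    rw [ContinuousAt, ← hemb.map_nhds_eq, Filter.tendsto_map'_iff, hgcomp, hgval]
    exact h1
  have hgi : InjOn g W := by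
    rintro _ ⟨z₁, hz₁, rfl⟩ _ ⟨z₂, hz₂, rfl⟩ h
    rw [hgval, hgval] at h
    rw [hinj hz₁.1 hz₂.1 (φ.injOn hz₁.2 hz₂.2 h)]
  have hopen : IsOpen (g '' W) :=
    Literature.Topology.Euclidean.Brouwer.isOpen_image_of_injOn rfl hWo hgc hgi
  have hO : IsOpen (φ.source ∩ φ ⁻¹' (g '' W)) :=
    φ.continuousOn.isOpen_inter_preimage φ.open_source hopen
  have hsub : φ.source ∩ φ ⁻¹' (g '' W) ⊆ f '' V := by
    rintro y ⟨hy, _, ⟨z, hz, rfl⟩, hzy⟩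
    rw [hgval] at hzy
    exact ⟨z, hz.1, φ.injOn hz.2 hy hzy⟩
  refine Filter.mem_of_superset (hO.mem_nhds ⟨mem_chart_source E4 (f x), ?_⟩) hsub
  exact ⟨x.1, ⟨x, hxV', rfl⟩, hgval x⟩

/-- **The image of an anchored window chart is a neighbourhood of its base point**: for an anchored window chart
`Ψ` at `q` (continuous and injective on the window) and an open `V ∋ x₀` inside the window, `Ψ '' V ∈ 𝓝 q`.
[cite: Tao2014, Thm. 6.0.12] -/
theorem image_mem_nhds_of_isWindowChart : ∀ {𝓢 : Spacetime.{0} 4} {M a R : ℝ} {x₀ : Kerr.exterior M a} {q : 𝓢.carrier} {Ψ : Kerr.exterior M a → 𝓢.carrier}, IsWindowChart 𝓢 M a x₀ R q Ψ → ∀ {V : Set (Kerr.exterior M a)}, IsOpen V → V ⊆ kerrWindow M a x₀ R → x₀ ∈ V → Ψ '' V ∈ 𝓝 q := by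
  intro 𝓢 M a R x₀ q Ψ hΨ V hV hVW hx₀
  have hopen : IsOpen (Ψ '' V) :=
    isOpen_image_of_continuousOn_injOn_opens hV (hΨ.contMDiffOn.continuousOn.mono hVW) (hΨ.injOn.mono hVW)
  rw [← hΨ.anchor]
  exact hopen.mem_nhds ⟨x₀, hx₀, rfl⟩

/-- Windows about nearby anchors: `B_{R'}(x₀') ⊆ B_R(x₀)` whenever `|x₀' − x₀| + R' ≤ R`. [folklore] -/
theorem kerrWindow_subset_of_dist_add_le : ∀ (M a : ℝ) (x₀ x₀' : Kerr.exterior M a) {R R' : ℝ}, dist x₀'.1 x₀.1 + R' ≤ R → kerrWindow M a x₀' R' ⊆ kerrWindow M a x₀ R := by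
  intro M a x₀ x₀' R R' h x hx
  have hx' : dist x.1 x₀'.1 < R' := hx
  show dist x.1 x₀.1 < R
  calc dist x.1 x₀.1 ≤ dist x.1 x₀'.1 + dist x₀'.1 x₀.1 := dist_triangle _ _ _
    _ < R := by linarith

/-- **Re-anchoring an anchored window chart.** If `Ψ` is an anchored window chart at `q` with anchor `x₀` and scale
`R`, then for every `x₀'` with `|x₀' − x₀| + R' ≤ R` the SAME map is an anchored window chart at `Ψ x₀'` with anchor
`x₀'` and scale `R'` (all four clauses restrict to the smaller window `B_{R'}(x₀') ⊆ B_R(x₀)`). [folklore] -/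
theorem isWindowChart_reanchor : ∀ {𝓢 : Spacetime.{0} 4} {M a R R' : ℝ} {x₀ : Kerr.exterior M a} {q : 𝓢.carrier} {Ψ : Kerr.exterior M a → 𝓢.carrier} (x₀' : Kerr.exterior M a), IsWindowChart 𝓢 M a x₀ R q Ψ → dist x₀'.1 x₀.1 + R' ≤ R → IsWindowChart 𝓢 M a x₀' R' (Ψ x₀') Ψ := by
  intro 𝓢 M a R R' x₀ q Ψ x₀' hΨ h
  have hsub := kerrWindow_subset_of_dist_add_le M a x₀ x₀' h
  exact ⟨rfl, hΨ.contMDiffOn.mono hsub, hΨ.injOn.mono hsub, fun x hx hr ↦ hΨ.future x (hsub hx) hr⟩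

/-- **The re-anchored chart bounds `kerrDev` at the nearby base point at the smaller scale**: with admissible
parameters, `kerrDev 𝓢 (Ψ x₀') R'` is at most the window `C²`-deviation of `Ψ` on the big window.
[cite: arXiv210408222, §1] -/
theorem kerrDev_apply_lt_of_isWindowChart : ∀ {𝓢 : Spacetime.{0} 4} {M a R R' : ℝ} {x₀ : Kerr.exterior M a} {q : 𝓢.carrier} {Ψ : Kerr.exterior M a → 𝓢.carrier} {ε : ℝ≥0∞} (x₀' : Kerr.exterior M a), 0 ≤ M → |a| ≤ M → IsWindowChart 𝓢 M a x₀ R q Ψ → supCkENorm (Subtype.val '' kerrWindow M a x₀ R) 2 (𝓢.deviationExtend (Kerr.background M a) Ψ) < ε → dist x₀'.1 x₀.1 + R' ≤ R → kerrDev 𝓢 (Ψ x₀') R' < ε := by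
  intro 𝓢 M a R R' x₀ q Ψ ε x₀' hM ha hΨ hdev h
  exact kerrDev_lt_of_isWindowChart hM ha (isWindowChart_reanchor x₀' hΨ h)
    ((supCkENorm_mono (image_mono (kerrWindow_subset_of_dist_add_le M a x₀ x₀' h)) _ _).trans_lt hdev)

/-- **Registered sub-goal `stub_kerrDev_usc_scaleLoss`: upper semicontinuity of `q ↦ kerrDev 𝓢 q ·` with scale
loss.** If `kerrDev 𝓢 q R < ε` and `R' < R`, then `kerrDev 𝓢 q' R' < ε` for all `q'` in a neighbourhood of `q`:
re-anchor one near-optimal chart (`kerrDev_lt_iff`) at the anchors `x₀' ∈ B_{R−R'}(x₀) ∩ {r > r₊}`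
(`kerrDev_apply_lt_of_isWindowChart`), whose `Ψ`-image is a neighbourhood of `q` by invariance of domain
(`image_mem_nhds_of_isWindowChart`); scales `R' ≤ 0` are trivial (`kerrDev_of_nonpos`). The scale loss is genuine for
open non-extendable windows; it disappears for the outer functional `⨅ R' > R, kerrDev 𝓢 q R'`
(`upperSemicontinuous_iInf_kerrDev`). [cite: Tao2014, Thm. 6.0.12] -/
theorem stub_kerrDev_usc_scaleLoss : ∀ {𝓢 : Spacetime.{0} 4} (q : 𝓢.carrier) {R R' : ℝ} (ε : ℝ≥0∞), R' < R → kerrDev 𝓢 q R < ε → ∀ᶠ q' in 𝓝 q, kerrDev 𝓢 q' R' < ε := by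
  intro 𝓢 q R R' ε hR hε
  rcases le_or_gt R' 0 with hR'0 | hR'0
  · exact Eventually.of_forall fun q' ↦ by
      rw [kerrDev_of_nonpos q' hR'0]
      exact zero_le.trans_lt hε
  obtain ⟨M, a, x₀, Ψ, hM, ha, hΨ, hdev⟩ := (kerrDev_lt_iff q R ε).1 hε
  have hδ : 0 < R - R' := sub_pos.2 hR
  have hV : kerrWindow M a x₀ (R - R') ⊆ kerrWindow M a x₀ R := kerrWindow_mono M a x₀ (by linarith)
  have hx₀ : x₀ ∈ kerrWindow M a x₀ (R - R') := by
    show dist x₀.1 x₀.1 < R - R'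
    rw [dist_self]
    exact hδ
  filter_upwards [image_mem_nhds_of_isWindowChart hΨ (isOpen_kerrWindow M a x₀ (R - R')) hV hx₀]
  rintro _ ⟨x₀', hx₀', rfl⟩
  have hlt : dist x₀'.1 x₀.1 < R - R' := hx₀'
  exact kerrDev_apply_lt_of_isWindowChart x₀' hM ha hΨ hdev (by linarith)

/-- **The outer functional `q ↦ ⨅ R' > R, kerrDev 𝓢 q R'` is upper semicontinuous at fixed scale** (the scale loss
of `stub_kerrDev_usc_scaleLoss` is absorbed by an intermediate scale `R < R'' < R'`): this is the fixed-scale upper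
semicontinuity that a `kerrDev` built on windows EXTENDABLE beyond scale `R` enjoys. [cite: Tao2014, Thm. 6.0.12] -/
theorem upperSemicontinuous_iInf_kerrDev : ∀ (𝓢 : Spacetime.{0} 4) (R : ℝ), UpperSemicontinuous fun q : 𝓢.carrier ↦ ⨅ (R' : ℝ) (_ : R < R'), kerrDev 𝓢 q R' := by
  intro 𝓢 R
  refine upperSemicontinuous_iff.2 fun q ↦ upperSemicontinuousAt_iff.2 fun y hy ↦ ?_
  obtain ⟨R', hR', hlt⟩ : ∃ R', R < R' ∧ kerrDev 𝓢 q R' < y := by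
    simpa only [iInf_lt_iff, exists_prop] using hy
  obtain ⟨R'', hRR'', hR''R'⟩ := exists_between hR'
  filter_upwards [stub_kerrDev_usc_scaleLoss q y hR''R' hlt] with q' hq'
  exact (iInf_le_of_le R'' <| iInf_le _ hRR'').trans_lt hq'

/-- **Along a continuous path the outer functional is upper semicontinuous in time**: for `γ : ℝ → 𝓢` continuous and
every scale `R`, `s ↦ ⨅ R' > R, kerrDev 𝓢 (γ s) R'` is upper semicontinuous — hence satisfies hypothesis (R-USC_b) of
`stub_hullConnectedness_of_oneSided` (companion file `…RHullConnectednessIVT.lean`) at every level, leaving only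
(NUJ-L_b) (the "no upward jump" half) open for it.
[cite: Tao2014, Thm. 6.0.12] -/
theorem upperSemicontinuous_iInf_kerrDev_comp : ∀ (𝓢 : Spacetime.{0} 4) (R : ℝ) {γ : ℝ → 𝓢.carrier}, Continuous γ → UpperSemicontinuous fun s ↦ ⨅ (R' : ℝ) (_ : R < R'), kerrDev 𝓢 (γ s) R' :=
  fun 𝓢 R _ hγ ↦ (upperSemicontinuous_iInf_kerrDev 𝓢 R).comp hγ

/-- **What the fixed-scale functional inherits along a continuous path** (right/left-u.s.c. WITH SCALE LOSS): if
`kerrDev 𝓢 (γ t) R < b` and `R' < R` then `kerrDev 𝓢 (γ s) R' < b` for all `s` near `t`. At `R' = R` this would be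
hypothesis (R-USC_b) of `stub_hullConnectedness_of_oneSided` (companion file); the gap `R' < R` is the
non-extendability of open window charts. [cite: Tao2014, Thm. 6.0.12] -/
theorem eventually_kerrDev_comp_lt_of_lt : ∀ (𝓢 : Spacetime.{0} 4) {γ : ℝ → 𝓢.carrier}, Continuous γ → ∀ {R R' : ℝ} {b : ℝ≥0∞} (t : ℝ), R' < R → kerrDev 𝓢 (γ t) R < b → ∀ᶠ s in 𝓝 t, kerrDev 𝓢 (γ s) R' < b :=
  fun _ _ hγ _ _ b t hR h ↦ (hγ.tendsto t).eventually (stub_kerrDev_usc_scaleLoss _ b hR h)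

end Summit.FinalStateConjecture.FinalStateConjecture.Theorems

end
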